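import Summits.CriticalPhenomena.PercolationContinuityZ3.Theorems.PercNearOneGluingNoHeavyLowerTailSahiOneStepDisjointOr
import HarnessLib

/-!
# One-step scheme: `(2′)` and Kahn C5 / Sahi `C₃` for READ-ONCE MONOTONE DNFs against an arbitrary increasing event

Prover prim-ineq-prove-3 gen 44 (`--supports stmt-CriticalPhenomena-4575`).  Corollary file of `…SahiOneStepDisjointOr` (no definitions, no sorries):
the event "some term of a read-once monotone DNF is satisfied", `B = {ω : ∃ j, S_j ⊆ ω}` with pairwise disjoint terms `S_j ⊆ F`, is the OR of the
block thresholds `{N_{S_j} ≥ |S_j|}`, so `osN_threshold_disjointOr_nonneg` / `sahiE3_threshold_disjointOr_nonneg` apply: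
for every product measure, every `t` and EVERY increasing `U`, `0 ≤ n(1_U, 1_B)` at the slot `{N_F ≥ t}` and `0 ≤ E₃(1_{N_F ≥ t}, 1_U, 1_B)`.
-/

noncomputable section

namespace Summit.CriticalPhenomena.PercolationContinuityZ3.Theorems

namespace SahiOneStep

open MeasureTheory Finset
open Literature.Probability.LatticeModels (prodBernoulli sahiE3)
open Literature.Probability.Percolation.DecisionTree (ind)
open scoped Classical

variable {ι : Type*} [Fintype ι] [DecidableEq ι]

omit [Fintype ι] [DecidableEq ι] in
/-- A term `S ⊆ ω` of a monotone DNF is the full block threshold `|S| ≤ N_S(ω)`. [folklore] -/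
theorem coe_subset_iff_card_le_card_filter (S : Finset ι) (ω : Set ι) :
    (↑S : Set ι) ⊆ ω ↔ S.card ≤ (S.filter (· ∈ ω)).card := by
  constructor
  · intro h
    rw [Finset.filter_true_of_mem fun i hi => h (Finset.mem_coe.2 hi)]
  · intro h i hi
    have heq : S.filter (· ∈ ω) = S := Finset.eq_of_subset_of_card_le (Finset.filter_subset _ _) h
    have : i ∈ S.filter (· ∈ ω) := by rw [heq]; exact Finset.mem_coe.1 hi
    exact (Finset.mem_filter.1 this).2

omit [Fintype ι] [DecidableEq ι] in
/-- The read-once DNF event as an OR of full block thresholds. [folklore] -/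
theorem setOf_exists_coe_subset_eq {κ₀ : Type*} (S : κ₀ → Finset ι) :
    {ω : Set ι | ∃ j, (↑(S j) : Set ι) ⊆ ω} = {ω : Set ι | ∃ j, (S j).card ≤ ((S j).filter (· ∈ ω)).card} := by
  ext ω
  simp only [Set.mem_setOf_eq, coe_subset_iff_card_le_card_filter]

/-- **`(2′)` FOR READ-ONCE MONOTONE DNFs.**  For every product measure, every block `F`, every `t`, pairwise disjoint terms `S_j ⊆ F` and EVERY
increasing `U`: `0 ≤ n(1_U, 1_{∃ j, S_j ⊆ ω})` at the slot `{N_F ≥ t}`. [this work] -/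
theorem osN_threshold_readOnceDNF_nonneg (p : ι → unitInterval) (F : Finset ι) (t : ℕ) {κ₀ : Type*} [Fintype κ₀] [DecidableEq κ₀]
    (S : κ₀ → Finset ι) (hSF : ∀ j, S j ⊆ F) (hdisj : ∀ j j', j ≠ j' → Disjoint (S j) (S j')) {U : Set (Set ι)} (hU : IsUpperSet U) :
    0 ≤ osN p {ω : Set ι | t ≤ (F.filter (· ∈ ω)).card} (ind U) (ind {ω : Set ι | ∃ j, (↑(S j) : Set ι) ⊆ ω}) := by
  rw [setOf_exists_coe_subset_eq S]
  exact osN_threshold_disjointOr_nonneg p F t S hSF hdisj (fun j => (S j).card) hU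

/-- **KAHN C5 / SAHI `C₃` FOR A HAMMING THRESHOLD, A READ-ONCE MONOTONE DNF AND AN ARBITRARY INCREASING EVENT** (every product measure):
`0 ≤ E₃(1_{N_F ≥ t}, 1_U, 1_{x_{S₁} ∨ … ∨ x_{S_k}})`. [this work] -/
theorem sahiE3_threshold_readOnceDNF_nonneg (p : ι → unitInterval) (F : Finset ι) (t : ℕ) {κ₀ : Type*} [Fintype κ₀] [DecidableEq κ₀]
    (S : κ₀ → Finset ι) (hSF : ∀ j, S j ⊆ F) (hdisj : ∀ j j', j ≠ j' → Disjoint (S j) (S j')) {U : Set (Set ι)} (hU : IsUpperSet U) :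
    0 ≤ sahiE3 (prodBernoulli p) {ω : Set ι | t ≤ (F.filter (· ∈ ω)).card} U {ω : Set ι | ∃ j, (↑(S j) : Set ι) ⊆ ω} := by
  rw [setOf_exists_coe_subset_eq S]
  exact sahiE3_threshold_disjointOr_nonneg p F t S hSF hdisj (fun j => (S j).card) hU

/-- The same with the two slots exchanged. [this work] -/
theorem sahiE3_threshold_readOnceDNF_nonneg' (p : ι → unitInterval) (F : Finset ι) (t : ℕ) {κ₀ : Type*} [Fintype κ₀] [DecidableEq κ₀]
    (S : κ₀ → Finset ι) (hSF : ∀ j, S j ⊆ F) (hdisj : ∀ j j', j ≠ j' → Disjoint (S j) (S j')) {U : Set (Set ι)} (hU : IsUpperSet U) :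
    0 ≤ sahiE3 (prodBernoulli p) {ω : Set ι | t ≤ (F.filter (· ∈ ω)).card} {ω : Set ι | ∃ j, (↑(S j) : Set ι) ⊆ ω} U := by
  rw [setOf_exists_coe_subset_eq S]
  exact sahiE3_threshold_disjointOr_nonneg' p F t S hSF hdisj (fun j => (S j).card) hU

end SahiOneStep

end Summit.CriticalPhenomena.PercolationContinuityZ3.Theorems
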